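import Summits.AtomisticToContinuum.FouriersLaw.Theorems.VanishingNoiseTransferNoisyFourierOfStorageDecay
import Literature.MathematicalPhysics.KineticTheory.VelocityFlipNoise
import HarnessLib

/-!
# The Kubo conductance floor is bulk Abel–Green–Kubo positivity (crux `VanishingNoiseTransfer.NoisyFourier`,
# stmt-AtomisticToContinuum-11977, line `abel-storage-decay`, stub P `stub_kuboConductanceFloor`)

`--supports stmt-AtomisticToContinuum-11977` file (worker of lead c6). Setting as in `…NoisyFourierOfStorageDecay`:
pinned anharmonic chain `𝐏 = pinnedChain ω₂ lam β γ` (parameters `> 0`), `T > 0`, Gibbs measure `μ_T`, flip-noisy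
equilibrium generator `L_ε = 𝐏.flipGenerator L T T ε` (`ε > 0`), total current `J_L = Σ_i j_i`, classical Abel
correctors `u_{L,s} ∈ C² ∩ L²(μ_T)`, `L_ε u = s u − J_L` (they exist: landed A2 `stub_abelCorrectorExists`), the
corrector-independent pairing `σ_L(s) = ∫ J_L u_{L,s} dμ_T`, classical forward fields `g ∈ C² ∩ L²(μ_T)`,
`L_ε g = −(p_0² − T)` (they exist: the landed dual forward fields of the sister crux), and the finite-volume Kubo
conductance `D_L = (L−1)·γ(1 − (γ/T²)∫ g (p_0² − T) dμ_T) = σ_L(0⁺)/(T²(L−1))` (landed A3 `stub_abelLimit`).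

The registered stub P of the line asks for `liminf_L D_L > 0`. This file moves its open content to the BULK:

* `kuboFloor_of_bulkPositivity` — **A4 + U⁺ + bulk Abel–GK positivity ⇒ P.** Here A4 is the registered stub
  `stub_fixedAbelThermodynamicLimit` (the fixed-`s` limits `σ_L(s)/(L−1) → K(s)` exist), U⁺ the registered
  `stub_zeroFrequencyStorageDecay` (`s∫u_{L,s}² ≤ C(L−1)s^a`; it gives the `L`-uniform upper Abel modulus U by the
  landed `upperAbelModulus_of_storageDecay`), and BULK ABEL–GK POSITIVITY is the floor
  `K ≥ κ₀T²` on whatever the fixed-`s` per-bond limits `K` of `σ_L(s)/(L−1)` are, for `s ≤ s₁` (stated without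
  definitions, vacuous-safe). Proof: with `η = κ₀T²/4`, U and A3 give `T²(L−1)D_L ≥ σ_L(s') − η(L−1)` for
  `s' = min(s₀(η), s₁)`, `L ≥ L₀(η)`; A4 and the bulk floor give `σ_L(s') > (K(s') − η)(L−1) ≥ (κ₀T² − η)(L−1)` for
  `L ≥ L₁`; hence `D_L ≥ κ₀/2` for EVERY forward field (A3 holds for every forward field).
* `bulkPositivity_of_kuboFloor` — **P ⇒ bulk Abel–GK positivity**, unconditionally: the landed FREE one-sided
  monotonicity M (`stub_abelMonotone`: `σ_L(s) − σ_L(t) ≥ −C₀L(s−t)`), A3 and P give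
  `σ_L(s)/(L−1) ≥ T²D_L − 2C₀s ≥ T²c − 2C₀s` for `L ≥ L₀`, so every limit is `≥ T²c/2` once `s ≤ T²c/(4(C₀+1))`
  (forward fields exist at every `L ≥ 2`: `forwardField_exists`, assembled from the landed flip steady states and
  dual forward fields exactly as in `noisyFourier_of_kuboLimit`).

So, given the other two stubs {A4, U⁺} of the line, the floor P is EQUIVALENT to positivity of the bulk Abel–GK
conductivity `liminf_{s→0⁺} lim_L σ_L(s)/(T²(L−1)) > 0` — the infinite-volume-flavoured Green–Kubo positivity of
the velocity-flip chain, which is the arena of Bernardin–Olla 2011 (J. Stat. Phys. 145) §6, where lower bounds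
are obtained only with the momentum-exchange noise; for flips alone it is open in print. Registered helpers:
`helper_kuboFloorOfBulkPositivity`, `helper_bulkPositivityOfKuboFloor`.

No definitions; axioms `propext`, `Classical.choice`, `Quot.sound` only. [folklore]
-/

noncomputable section

open MeasureTheory Filter Topology Finset
open scoped BigOperators

namespace Summit.AtomisticToContinuum.FouriersLaw.Theorems.NoisyFourier.KuboFloor

open Literature.MathematicalPhysics.KineticTheory.HeatConduction
open Summit.AtomisticToContinuum.FouriersLaw.Theorems.SuperadditiveResistance.DeviceLiouville (kin)
open Summit.AtomisticToContinuum.FouriersLaw.Cruxes.NoisyFourier.AbelKapitzaEvenCorrector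
  (stub_abelCorrectorExists stub_abelLimit stub_abelMonotone)
open Summit.AtomisticToContinuum.FouriersLaw.Theorems.NoisyFourier.StorageDecay (upperAbelModulus_of_storageDecay)
open Summit.AtomisticToContinuum.FouriersLaw.Cruxes.ConductanceLowerBound.ForecastSensitivity
  (memLp_two_of_abs_le_exp)

/-! ## Classical forward fields exist (landed assembly) -/

/-- **Classical forward fields exist at every `L ≥ 2`.** For parameters `> 0`, `T > 0`, `ε > 0` there is
`g ∈ C² ∩ L²(μ_T)` with `(L_{T,T} + εS) g = −(p_0² − T)` pointwise: the `δ = 0` member of the landed dual forward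
fields (`FlipPositiveConductance.dualForwardFields_of_mild_hypo_upgrade_cont` fed with the four landed
`VanishingNoiseBound` stubs) along the canonical flip-steady family (landed `stub_flipNessExists`,
`flipNessUnique`), `L²` by its `exp(H/(4T))` bound (`memLp_two_of_abs_le_exp`); the assembly of
`noisyFourier_of_kuboLimit`, isolated. [folklore] -/
theorem forwardField_exists {ω₂ lam β γ T ε : ℝ} (hω : 0 < ω₂) (hl : 0 < lam) (hβ : 0 < β) (hγ : 0 < γ)
    (hT : 0 < T) (hε : 0 < ε) (L : ℕ) (hL : 2 ≤ L) :
    ∃ g : PhaseSpace L → ℝ, ContDiff ℝ 2 g ∧ MemLp g 2 ((pinnedChain ω₂ lam β γ).gibbsMeasure L T) ∧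
      ∀ x, (pinnedChain ω₂ lam β γ).flipGenerator L T T ε g x = -(kin L 0 x - T) := by
  have hEU := LineAssembly.existsUnique_of_exists_of_unique
    Summit.AtomisticToContinuum.FouriersLaw.Cruxes.NoisyFourier.SectorDirichletGluing.stub_flipNessExists
    Summit.AtomisticToContinuum.FouriersLaw.Cruxes.NoisyFourier.SectorDirichletGluing.flipNessUnique
    ω₂ lam β γ hω hl hβ hγ ε hε
  classical
  let μ₀ : (N : ℕ) → ℝ → ℝ → Measure (PhaseSpace N) := fun N T_L T_R =>
    if h : 0 < T_L ∧ 0 < T_R then Classical.choose (hEU N T_L T_R h.1 h.2) else 0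
  have hμ₀ : ∀ (N : ℕ) (T_L T_R : ℝ), 0 < T_L → 0 < T_R →
      (pinnedChain ω₂ lam β γ).IsFlipSteadyState N T_L T_R ε (μ₀ N T_L T_R) ∧
        ∀ ν : Measure (PhaseSpace N),
          (pinnedChain ω₂ lam β γ).IsFlipSteadyState N T_L T_R ε ν → ν = μ₀ N T_L T_R := by
    intro N T_L T_R hLt hRt
    simp only [μ₀, dif_pos (And.intro hLt hRt)]
    exact Classical.choose_spec (hEU N T_L T_R hLt hRt)
  obtain ⟨g, δ₀, hδ₀, hC, hpde, hbd, -, -, -⟩ :=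
    FlipPositiveConductance.dualForwardFields_of_mild_hypo_upgrade_cont
      VanishingNoiseBound.stub_flipMildDistributional VanishingNoiseBound.stub_flipHypoelliptic
      VanishingNoiseBound.stub_flipSmoothMildUpgrade VanishingNoiseBound.stub_flipMildContinuity
      ω₂ lam β γ T ε hω hl hβ hγ hT hε μ₀ hμ₀ L hL
  obtain ⟨C₀, hgb0⟩ := hbd 0 (by simpa using hδ₀)
  have h14' : 2 * (1 / (4 * T)) < 1 / T := by
    rw [show 2 * (1 / (4 * T)) = 1 / (2 * T) by field_simp; ring, div_lt_div_iff₀ (by positivity) hT]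
    nlinarith
  exact ⟨g 0, hC, memLp_two_of_abs_le_exp hω hl.le hβ.le γ L hT h14' hC.continuous hgb0, hpde⟩

/-! ## `A4 + U⁺ + bulk positivity ⇒ P` -/

/-- **Bulk Abel–GK positivity implies the Kubo conductance floor, given A4 and U⁺.** Hypotheses: `hA4` = the
registered stub `stub_fixedAbelThermodynamicLimit` (fixed-`s` thermodynamic limit of `σ_L(s)/(L−1)` along every
classical corrector family), `hSD` = the registered stub `stub_zeroFrequencyStorageDecay` (U⁺), `hBulk` = bulk
Abel–GK positivity (a floor `κ₀T²` on the fixed-`s` limits for `s ≤ s₁`). Conclusion: the registered stub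
`stub_kuboConductanceFloor` (P) with `c = κ₀/2`. See the module docstring for the three-line argument
(U via `upperAbelModulus_of_storageDecay` at `η = κ₀T²/4`, A3 `stub_abelLimit` for every forward field, A4 at
`s' = min(s₀, s₁)`). [folklore] -/
theorem kuboFloor_of_bulkPositivity
    (hA4 : ∀ (ω₂ lam β γ T ε : ℝ), 0 < ω₂ → 0 < lam → 0 < β → 0 < γ → 0 < T → 0 < ε →
      ∀ s : ℝ, 0 < s → s ≤ 1 → ∀ u : (L : ℕ) → PhaseSpace L → ℝ,
        (∀ L : ℕ, 2 ≤ L → ContDiff ℝ 2 (u L) ∧ MemLp (u L) 2 ((pinnedChain ω₂ lam β γ).gibbsMeasure L T) ∧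
          ∀ x, (pinnedChain ω₂ lam β γ).flipGenerator L T T ε (u L) x =
            s * u L x - ∑ i : Fin L, (pinnedChain ω₂ lam β γ).bondCurrent L i x) →
        ∃ K : ℝ, Tendsto (fun L : ℕ => (∫ x, (∑ i : Fin L, (pinnedChain ω₂ lam β γ).bondCurrent L i x) * u L x
          ∂((pinnedChain ω₂ lam β γ).gibbsMeasure L T)) / ((L : ℝ) - 1)) atTop (𝓝 K))
    (hSD : ∀ (ω₂ lam β γ T ε : ℝ), 0 < ω₂ → 0 < lam → 0 < β → 0 < γ → 0 < T → 0 < ε →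
      ∃ a C : ℝ, 0 < a ∧ a ≤ 1 ∧ 0 ≤ C ∧ ∀ (L : ℕ), 2 ≤ L → ∀ s : ℝ, 0 < s → s ≤ 1 →
        ∀ u : PhaseSpace L → ℝ,
          (ContDiff ℝ 2 u ∧ MemLp u 2 ((pinnedChain ω₂ lam β γ).gibbsMeasure L T) ∧
            ∀ x, (pinnedChain ω₂ lam β γ).flipGenerator L T T ε u x =
              s * u x - ∑ i : Fin L, (pinnedChain ω₂ lam β γ).bondCurrent L i x) →
          s * ∫ x, u x ^ 2 ∂((pinnedChain ω₂ lam β γ).gibbsMeasure L T) ≤ C * ((L : ℝ) - 1) * s ^ a)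
    (hBulk : ∀ (ω₂ lam β γ T ε : ℝ), 0 < ω₂ → 0 < lam → 0 < β → 0 < γ → 0 < T → 0 < ε →
      ∃ κ₀ : ℝ, 0 < κ₀ ∧ ∃ s₁ : ℝ, 0 < s₁ ∧ s₁ ≤ 1 ∧ ∀ s : ℝ, 0 < s → s ≤ s₁ →
        ∀ u : (L : ℕ) → PhaseSpace L → ℝ,
          (∀ L : ℕ, 2 ≤ L → ContDiff ℝ 2 (u L) ∧ MemLp (u L) 2 ((pinnedChain ω₂ lam β γ).gibbsMeasure L T) ∧
            ∀ x, (pinnedChain ω₂ lam β γ).flipGenerator L T T ε (u L) x =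
              s * u L x - ∑ i : Fin L, (pinnedChain ω₂ lam β γ).bondCurrent L i x) →
          ∀ K : ℝ, Tendsto (fun L : ℕ => (∫ x, (∑ i : Fin L, (pinnedChain ω₂ lam β γ).bondCurrent L i x) * u L x
            ∂((pinnedChain ω₂ lam β γ).gibbsMeasure L T)) / ((L : ℝ) - 1)) atTop (𝓝 K) → κ₀ * T ^ 2 ≤ K) :
    ∀ (ω₂ lam β γ T ε : ℝ), 0 < ω₂ → 0 < lam → 0 < β → 0 < γ → 0 < T → 0 < ε →
      ∃ c : ℝ, 0 < c ∧ ∃ L₀ : ℕ, ∀ (L : ℕ), L₀ ≤ L → 2 ≤ L → ∀ g : PhaseSpace L → ℝ,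
        (ContDiff ℝ 2 g ∧ MemLp g 2 ((pinnedChain ω₂ lam β γ).gibbsMeasure L T) ∧
          ∀ x, (pinnedChain ω₂ lam β γ).flipGenerator L T T ε g x = -(kin L 0 x - T)) →
        c ≤ ((L : ℝ) - 1) * (γ * (1 - γ / T ^ 2 *
          ∫ x, g x * (kin L 0 x - T) ∂((pinnedChain ω₂ lam β γ).gibbsMeasure L T))) := by
  intro ω₂ lam β γ T ε hω hl hβ hγ hT hε
  classical
  set P := pinnedChain ω₂ lam β γ with hP
  have hT2 : 0 < T ^ 2 := by positivity
  obtain ⟨κ₀, hκ₀, s₁, hs₁, hs₁1, hB⟩ := hBulk ω₂ lam β γ T ε hω hl hβ hγ hT hε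
  -- U (from U⁺, landed) at tolerance `η = κ₀T²/4`
  obtain ⟨s₀, hs₀, hs₀1, L₀, hU⟩ :=
    (upperAbelModulus_of_storageDecay hSD) ω₂ lam β γ T ε hω hl hβ hγ hT hε (κ₀ * T ^ 2 / 4) (by positivity)
  -- the scale
  set s' : ℝ := min s₀ s₁ with hs'def
  have hs' : 0 < s' := lt_min hs₀ hs₁
  have hs'₀ : s' ≤ s₀ := min_le_left _ _
  have hs'₁ : s' ≤ s₁ := min_le_right _ _
  have hs'1 : s' ≤ 1 := hs'₀.trans hs₀1
  -- classical Abel correctors (A2, landed), junk `0` off `s > 0` or `L < 2`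
  have hA2 := stub_abelCorrectorExists ω₂ lam β γ T ε hω hl hβ hγ hT hε
  set uc : (L : ℕ) → ℝ → PhaseSpace L → ℝ := fun L s =>
    if h : 2 ≤ L ∧ 0 < s then (hA2 L h.1 s h.2).choose else fun _ => 0 with hucdef
  have huc : ∀ (L : ℕ), 2 ≤ L → ∀ s : ℝ, 0 < s →
      ContDiff ℝ 2 (uc L s) ∧ MemLp (uc L s) 2 (P.gibbsMeasure L T) ∧
        ∀ x, P.flipGenerator L T T ε (uc L s) x = s * uc L s x - ∑ i : Fin L, P.bondCurrent L i x := by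
    intro L hL s hs
    have e : uc L s = (hA2 L hL s hs).choose := by simp only [hucdef, dif_pos (And.intro hL hs)]
    rw [e]
    exact (hA2 L hL s hs).choose_spec
  -- A4 at `s'` along the correctors, and the bulk floor on its limit
  obtain ⟨Kinf, hKinf⟩ := hA4 ω₂ lam β γ T ε hω hl hβ hγ hT hε s' hs' hs'1 (fun L => uc L s')
    (fun L hL => huc L hL s' hs')
  have hKfl : κ₀ * T ^ 2 ≤ Kinf :=
    hB s' hs' hs'₁ (fun L => uc L s') (fun L hL => huc L hL s' hs') Kinf hKinf
  have hev : ∀ᶠ L : ℕ in atTop, Kinf - κ₀ * T ^ 2 / 4 <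
      (∫ x, (∑ i : Fin L, P.bondCurrent L i x) * uc L s' x ∂(P.gibbsMeasure L T)) / ((L : ℝ) - 1) :=
    hKinf.eventually_const_lt (by linarith [mul_pos hκ₀ hT2])
  obtain ⟨L₁, hL₁⟩ := eventually_atTop.1 hev
  refine ⟨κ₀ / 2, by positivity, max L₀ L₁, fun L hLm hL g hg => ?_⟩
  have hL₀L : L₀ ≤ L := le_of_max_le_left hLm
  have hL₁L : L₁ ≤ L := le_of_max_le_right hLm
  have hN1 : 0 < (L : ℝ) - 1 := by
    have : (2 : ℝ) ≤ L := by exact_mod_cast hL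
    linarith
  -- A3 (landed) for THIS forward field along the correctors
  have hlim := stub_abelLimit ω₂ lam β γ T ε hω hl hβ hγ hT hε L hL g hg (uc L) (fun s hs _ => huc L hL s hs)
  -- U below `s'`
  have hevU : ∀ᶠ s in 𝓝[>] (0 : ℝ),
      (∫ x, (∑ i : Fin L, P.bondCurrent L i x) * uc L s' x ∂(P.gibbsMeasure L T)) -
          κ₀ * T ^ 2 / 4 * ((L : ℝ) - 1) ≤
        ∫ x, (∑ i : Fin L, P.bondCurrent L i x) * uc L s x ∂(P.gibbsMeasure L T) := by
    filter_upwards [Ioc_mem_nhdsGT hs'] with s hs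
    have hb := hU L hL₀L hL s s' hs.1 hs.2 hs'₀ (uc L s) (uc L s') (huc L hL s hs.1) (huc L hL s' hs')
    linarith
  haveI : (𝓝[>] (0 : ℝ)).NeBot := nhdsGT_neBot 0
  have hge : (∫ x, (∑ i : Fin L, P.bondCurrent L i x) * uc L s' x ∂(P.gibbsMeasure L T)) -
        κ₀ * T ^ 2 / 4 * ((L : ℝ) - 1) ≤
      ((L : ℝ) - 1) ^ 2 * (γ * (T ^ 2 - γ * ∫ x, g x * (kin L 0 x - T) ∂(P.gibbsMeasure L T))) :=
    ge_of_tendsto hlim hevU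
  -- A4 + bulk floor at level `L ≥ L₁`
  have h1 := hL₁ L hL₁L
  rw [lt_div_iff₀ hN1] at h1
  have h3 : (κ₀ * T ^ 2 - κ₀ * T ^ 2 / 4) * ((L : ℝ) - 1) ≤ (Kinf - κ₀ * T ^ 2 / 4) * ((L : ℝ) - 1) :=
    mul_le_mul_of_nonneg_right (by linarith) hN1.le
  -- divide by `T² (L − 1)`
  have e : ((L : ℝ) - 1) * (γ * (1 - γ / T ^ 2 * ∫ x, g x * (kin L 0 x - T) ∂(P.gibbsMeasure L T))) =
      ((L : ℝ) - 1) ^ 2 * (γ * (T ^ 2 - γ * ∫ x, g x * (kin L 0 x - T) ∂(P.gibbsMeasure L T))) /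
        (T ^ 2 * ((L : ℝ) - 1)) := by
    field_simp
  rw [e, le_div_iff₀ (mul_pos hT2 hN1)]
  linarith [hge, h1, h3]

/-! ## `P ⇒ bulk positivity` (free, by M) -/

/-- **The Kubo conductance floor implies bulk Abel–GK positivity** (no further hypotheses). If `D_L ≥ c > 0` for
every forward field at every `L ≥ L₀` (the registered stub P, hypothesis `hFloor`), then with `C₀` the constant of
the landed one-sided monotonicity M (`stub_abelMonotone`), every fixed-`s` per-bond limit `K` of `σ_L(s)/(L−1)`
along classical correctors satisfies `K ≥ (c/2)T²` for `0 < s ≤ min(1, T²c/(4(C₀+1)))`: M between a corrector at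
`t ≤ s` and the given one at `s`, A3 (`stub_abelLimit`) as `t → 0⁺` with a forward field from
`forwardField_exists`, P, and `L ≤ 2(L−1)`. Hence, given A4 and U⁺, P ⟺ bulk Abel–GK positivity. [folklore] -/
theorem bulkPositivity_of_kuboFloor
    (hFloor : ∀ (ω₂ lam β γ T ε : ℝ), 0 < ω₂ → 0 < lam → 0 < β → 0 < γ → 0 < T → 0 < ε →
      ∃ c : ℝ, 0 < c ∧ ∃ L₀ : ℕ, ∀ (L : ℕ), L₀ ≤ L → 2 ≤ L → ∀ g : PhaseSpace L → ℝ,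
        (ContDiff ℝ 2 g ∧ MemLp g 2 ((pinnedChain ω₂ lam β γ).gibbsMeasure L T) ∧
          ∀ x, (pinnedChain ω₂ lam β γ).flipGenerator L T T ε g x = -(kin L 0 x - T)) →
        c ≤ ((L : ℝ) - 1) * (γ * (1 - γ / T ^ 2 *
          ∫ x, g x * (kin L 0 x - T) ∂((pinnedChain ω₂ lam β γ).gibbsMeasure L T)))) :
    ∀ (ω₂ lam β γ T ε : ℝ), 0 < ω₂ → 0 < lam → 0 < β → 0 < γ → 0 < T → 0 < ε →
      ∃ κ₀ : ℝ, 0 < κ₀ ∧ ∃ s₁ : ℝ, 0 < s₁ ∧ s₁ ≤ 1 ∧ ∀ s : ℝ, 0 < s → s ≤ s₁ →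
        ∀ u : (L : ℕ) → PhaseSpace L → ℝ,
          (∀ L : ℕ, 2 ≤ L → ContDiff ℝ 2 (u L) ∧ MemLp (u L) 2 ((pinnedChain ω₂ lam β γ).gibbsMeasure L T) ∧
            ∀ x, (pinnedChain ω₂ lam β γ).flipGenerator L T T ε (u L) x =
              s * u L x - ∑ i : Fin L, (pinnedChain ω₂ lam β γ).bondCurrent L i x) →
          ∀ K : ℝ, Tendsto (fun L : ℕ => (∫ x, (∑ i : Fin L, (pinnedChain ω₂ lam β γ).bondCurrent L i x) * u L x
            ∂((pinnedChain ω₂ lam β γ).gibbsMeasure L T)) / ((L : ℝ) - 1)) atTop (𝓝 K) → κ₀ * T ^ 2 ≤ K := by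
  intro ω₂ lam β γ T ε hω hl hβ hγ hT hε
  classical
  set P := pinnedChain ω₂ lam β γ with hP
  have hT2 : 0 < T ^ 2 := by positivity
  obtain ⟨c, hc, L₀, hfl⟩ := hFloor ω₂ lam β γ T ε hω hl hβ hγ hT hε
  obtain ⟨C₀, hC₀, hMono⟩ := stub_abelMonotone ω₂ lam β γ T ε hω hl hβ hγ hT hε
  set s₁ : ℝ := min 1 (T ^ 2 * c / (4 * (C₀ + 1))) with hs₁def
  have hs₁ : 0 < s₁ := lt_min one_pos (by positivity)
  have hs₁1 : s₁ ≤ 1 := min_le_left _ _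
  refine ⟨c / 2, by positivity, s₁, hs₁, hs₁1, fun s hs hss₁ u hu K hK => ?_⟩
  -- the choice of `s₁`: `2 C₀ s ≤ T² c / 2`
  have hCs : 2 * C₀ * s ≤ T ^ 2 * c / 2 := by
    have h1 : s ≤ T ^ 2 * c / (4 * (C₀ + 1)) := hss₁.trans (min_le_right _ _)
    have h2 : 2 * C₀ * s ≤ 2 * C₀ * (T ^ 2 * c / (4 * (C₀ + 1))) := mul_le_mul_of_nonneg_left h1 (by positivity)
    refine h2.trans ?_
    rw [show 2 * C₀ * (T ^ 2 * c / (4 * (C₀ + 1))) = (C₀ / (C₀ + 1)) * (T ^ 2 * c / 2) by field_simp; ring]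
    have h3 : C₀ / (C₀ + 1) ≤ 1 := (div_le_one (by positivity)).2 (by linarith)
    exact mul_le_of_le_one_left (by positivity) h3
  -- classical Abel correctors (A2, landed), junk `0` off `t > 0` or `L < 2`
  have hA2 := stub_abelCorrectorExists ω₂ lam β γ T ε hω hl hβ hγ hT hε
  set uc : (L : ℕ) → ℝ → PhaseSpace L → ℝ := fun L t =>
    if h : 2 ≤ L ∧ 0 < t then (hA2 L h.1 t h.2).choose else fun _ => 0 with hucdef
  have huc : ∀ (L : ℕ), 2 ≤ L → ∀ t : ℝ, 0 < t →
      ContDiff ℝ 2 (uc L t) ∧ MemLp (uc L t) 2 (P.gibbsMeasure L T) ∧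
        ∀ x, P.flipGenerator L T T ε (uc L t) x = t * uc L t x - ∑ i : Fin L, P.bondCurrent L i x := by
    intro L hL t ht
    have e : uc L t = (hA2 L hL t ht).choose := by simp only [hucdef, dif_pos (And.intro hL ht)]
    rw [e]
    exact (hA2 L hL t ht).choose_spec
  -- eventually in `L`: `σ_L(s)/(L−1) ≥ T²c − 2C₀s`
  have hev : ∀ᶠ L : ℕ in atTop, T ^ 2 * c - 2 * C₀ * s ≤
      (∫ x, (∑ i : Fin L, P.bondCurrent L i x) * u L x ∂(P.gibbsMeasure L T)) / ((L : ℝ) - 1) := by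
    filter_upwards [eventually_ge_atTop 2, eventually_ge_atTop L₀] with L hL hL₀
    have hL2 : (2 : ℝ) ≤ L := by exact_mod_cast hL
    have hN1 : 0 < (L : ℝ) - 1 := by linarith
    obtain ⟨g, hg⟩ := forwardField_exists hω hl hβ hγ hT hε L hL
    have hD := hfl L hL₀ hL g hg
    have hlim := stub_abelLimit ω₂ lam β γ T ε hω hl hβ hγ hT hε L hL g hg (uc L) (fun t ht _ => huc L hL t ht)
    -- M between `uc L t` (`t ≤ s`) and the given corrector `u L` at `s`
    have hevM : ∀ᶠ t in 𝓝[>] (0 : ℝ),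
        ∫ x, (∑ i : Fin L, P.bondCurrent L i x) * uc L t x ∂(P.gibbsMeasure L T) ≤
          (∫ x, (∑ i : Fin L, P.bondCurrent L i x) * u L x ∂(P.gibbsMeasure L T)) + C₀ * L * s := by
      filter_upwards [Ioc_mem_nhdsGT hs] with t ht
      have hb := hMono L hL t s ht.1 ht.2 (uc L t) (u L) (huc L hL t ht.1) (hu L hL)
      have h4 : C₀ * L * (s - t) ≤ C₀ * L * s :=
        mul_le_mul_of_nonneg_left (by linarith [ht.1]) (by positivity)
      linarith
    haveI : (𝓝[>] (0 : ℝ)).NeBot := nhdsGT_neBot 0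
    have hle : ((L : ℝ) - 1) ^ 2 * (γ * (T ^ 2 - γ * ∫ x, g x * (kin L 0 x - T) ∂(P.gibbsMeasure L T))) ≤
        (∫ x, (∑ i : Fin L, P.bondCurrent L i x) * u L x ∂(P.gibbsMeasure L T)) + C₀ * L * s :=
      le_of_tendsto hlim hevM
    -- P, multiplied by `T² (L − 1)`
    have e : ((L : ℝ) - 1) ^ 2 * (γ * (T ^ 2 - γ * ∫ x, g x * (kin L 0 x - T) ∂(P.gibbsMeasure L T))) =
        T ^ 2 * ((L : ℝ) - 1) *
          (((L : ℝ) - 1) * (γ * (1 - γ / T ^ 2 * ∫ x, g x * (kin L 0 x - T) ∂(P.gibbsMeasure L T)))) := by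
      field_simp
    have hD' : T ^ 2 * ((L : ℝ) - 1) * c ≤
        ((L : ℝ) - 1) ^ 2 * (γ * (T ^ 2 - γ * ∫ x, g x * (kin L 0 x - T) ∂(P.gibbsMeasure L T))) := by
      rw [e]
      exact mul_le_mul_of_nonneg_left hD (by positivity)
    have hLL : (L : ℝ) ≤ 2 * ((L : ℝ) - 1) := by linarith
    have h4 : C₀ * L * s ≤ C₀ * (2 * ((L : ℝ) - 1)) * s :=
      mul_le_mul_of_nonneg_right (mul_le_mul_of_nonneg_left hLL hC₀) hs.le
    rw [le_div_iff₀ hN1]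
    linarith [hle, hD', h4]
  have hK' : T ^ 2 * c - 2 * C₀ * s ≤ K := ge_of_tendsto hK hev
  linarith [hCs]

/-! ## Registered helpers (notation-free restatements) -/

/-- Registered helper sub-goal `helper_kuboFloorOfBulkPositivity` of crux stmt-AtomisticToContinuum-11977 (line
`abel-storage-decay`, stub P `stub_kuboConductanceFloor`): the registered stubs A4 (`stub_fixedAbelThermodynamicLimit`)
and U⁺ (`stub_zeroFrequencyStorageDecay`), verbatim as hypotheses, together with bulk Abel–GK positivity, imply the
registered stub P verbatim (`kuboFloor_of_bulkPositivity`, restated). [folklore] -/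
theorem helper_kuboFloorOfBulkPositivity : (∀ (ω₂ lam β γ T ε : ℝ), 0 < ω₂ → 0 < lam → 0 < β → 0 < γ → 0 < T → 0 < ε → ∀ s : ℝ, 0 < s → s ≤ 1 → ∀ u : (L : ℕ) → Literature.MathematicalPhysics.KineticTheory.HeatConduction.PhaseSpace L → ℝ, (∀ L : ℕ, 2 ≤ L → ContDiff ℝ 2 (u L) ∧ MeasureTheory.MemLp (u L) 2 ((Literature.MathematicalPhysics.KineticTheory.HeatConduction.pinnedChain ω₂ lam β γ).gibbsMeasure L T) ∧ ∀ x, (Literature.MathematicalPhysics.KineticTheory.HeatConduction.pinnedChain ω₂ lam β γ).flipGenerator L T T ε (u L) x = s * u L x - ∑ i : Fin L, (Literature.MathematicalPhysics.KineticTheory.HeatConduction.pinnedChain ω₂ lam β γ).bondCurrent L i x) → ∃ K : ℝ, Filter.Tendsto (fun L : ℕ => (MeasureTheory.integral ((Literature.MathematicalPhysics.KineticTheory.HeatConduction.pinnedChain ω₂ lam β γ).gibbsMeasure L T) (fun x => (∑ i : Fin L, (Literature.MathematicalPhysics.KineticTheory.HeatConduction.pinnedChain ω₂ lam β γ).bondCurrent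 L i x) * u L x)) / ((L : ℝ) - 1)) Filter.atTop (nhds K)) → (∀ (ω₂ lam β γ T ε : ℝ), 0 < ω₂ → 0 < lam → 0 < β → 0 < γ → 0 < T → 0 < ε → ∃ a C : ℝ, 0 < a ∧ a ≤ 1 ∧ 0 ≤ C ∧ ∀ (L : ℕ), 2 ≤ L → ∀ s : ℝ, 0 < s → s ≤ 1 → ∀ u : Literature.MathematicalPhysics.KineticTheory.HeatConduction.PhaseSpace L → ℝ, (ContDiff ℝ 2 u ∧ MeasureTheory.MemLp u 2 ((Literature.MathematicalPhysics.KineticTheory.HeatConduction.pinnedChain ω₂ lam β γ).gibbsMeasure L T) ∧ ∀ x, (Literature.MathematicalPhysics.KineticTheory.HeatConduction.pinnedChain ω₂ lam β γ).flipGenerator L T T ε u x = s * u x - ∑ i : Fin L, (Literature.MathematicalPhysics.KineticTheory.HeatConduction.pinnedChain ω₂ lam β γ).bondCurrent L i x) → s * MeasureTheory.integral ((Literature.MathematicalPhysics.KineticTheory.HeatConduction.pinnedChain ω₂ lam β γ).gibbsMeasure L T) (fun x => u x ^ 2) ≤ C * ((L : ℝ) - 1) * s ^ a) → (∀ (ω₂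 lam β γ T ε : ℝ), 0 < ω₂ → 0 < lam → 0 < β → 0 < γ → 0 < T → 0 < ε → ∃ κ₀ : ℝ, 0 < κ₀ ∧ ∃ s₁ : ℝ, 0 < s₁ ∧ s₁ ≤ 1 ∧ ∀ s : ℝ, 0 < s → s ≤ s₁ → ∀ u : (L : ℕ) → Literature.MathematicalPhysics.KineticTheory.HeatConduction.PhaseSpace L → ℝ, (∀ L : ℕ, 2 ≤ L → ContDiff ℝ 2 (u L) ∧ MeasureTheory.MemLp (u L) 2 ((Literature.MathematicalPhysics.KineticTheory.HeatConduction.pinnedChain ω₂ lam β γ).gibbsMeasure L T) ∧ ∀ x, (Literature.MathematicalPhysics.KineticTheory.HeatConduction.pinnedChain ω₂ lam β γ).flipGenerator L T T ε (u L) x = s * u L x - ∑ i : Fin L, (Literature.MathematicalPhysics.KineticTheory.HeatConduction.pinnedChain ω₂ lam β γ).bondCurrent L i x) → ∀ K : ℝ, Filter.Tendsto (fun L : ℕ => (MeasureTheory.integral ((Literature.MathematicalPhysics.KineticTheory.HeatConduction.pinnedChain ω₂ lam β γ).gibbsMeasure L T) (fun x => (∑ i : Fin L, (Literature.MathematicalPhysics.KineticTheory.HeatConduction.pinnedChain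 ω₂ lam β γ).bondCurrent L i x) * u L x)) / ((L : ℝ) - 1)) Filter.atTop (nhds K) → κ₀ * T ^ 2 ≤ K) → (∀ (ω₂ lam β γ T ε : ℝ), 0 < ω₂ → 0 < lam → 0 < β → 0 < γ → 0 < T → 0 < ε → ∃ c : ℝ, 0 < c ∧ ∃ L₀ : ℕ, ∀ (L : ℕ), L₀ ≤ L → 2 ≤ L → ∀ g : Literature.MathematicalPhysics.KineticTheory.HeatConduction.PhaseSpace L → ℝ, (ContDiff ℝ 2 g ∧ MeasureTheory.MemLp g 2 ((Literature.MathematicalPhysics.KineticTheory.HeatConduction.pinnedChain ω₂ lam β γ).gibbsMeasure L T) ∧ ∀ x, (Literature.MathematicalPhysics.KineticTheory.HeatConduction.pinnedChain ω₂ lam β γ).flipGenerator L T T ε g x = -(Summit.AtomisticToContinuum.FouriersLaw.Theorems.SuperadditiveResistance.DeviceLiouville.kin L 0 x - T)) → c ≤ ((L : ℝ) - 1) * (γ * (1 - γ / T ^ 2 * MeasureTheory.integral ((Literature.MathematicalPhysics.KineticTheory.HeatConduction.pinnedChain ω₂ lam β γ).gibbsMeasure L T) (fun x => g x * (Summit.AtomisticToContinuum.FouriersLaw.Theorems.SuperadditiveResistance.DeviceLiouville.kin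 L 0 x - T))))) :=
  fun hA4 hSD hBulk => kuboFloor_of_bulkPositivity hA4 hSD hBulk

/-- Registered helper sub-goal `helper_bulkPositivityOfKuboFloor` of crux stmt-AtomisticToContinuum-11977 (line
`abel-storage-decay`, stub P `stub_kuboConductanceFloor`): the registered stub P verbatim implies bulk Abel–GK
positivity, unconditionally (`bulkPositivity_of_kuboFloor`, restated); with `helper_kuboFloorOfBulkPositivity`,
P is equivalent to bulk Abel–GK positivity given A4 and U⁺. [folklore] -/
theorem helper_bulkPositivityOfKuboFloor : (∀ (ω₂ lam β γ T ε : ℝ), 0 < ω₂ → 0 < lam → 0 < β → 0 < γ → 0 < T → 0 < ε → ∃ c : ℝ, 0 < c ∧ ∃ L₀ : ℕ, ∀ (L : ℕ), L₀ ≤ L → 2 ≤ L → ∀ g : Literature.MathematicalPhysics.KineticTheory.HeatConduction.PhaseSpace L → ℝ, (ContDiff ℝ 2 g ∧ MeasureTheory.MemLp g 2 ((Literature.MathematicalPhysics.KineticTheory.HeatConduction.pinnedChain ω₂ lam β γ).gibbsMeasure L T) ∧ ∀ x, (Literature.MathematicalPhysics.KineticTheory.HeatConduction.pinnedChain ω₂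 lam β γ).flipGenerator L T T ε g x = -(Summit.AtomisticToContinuum.FouriersLaw.Theorems.SuperadditiveResistance.DeviceLiouville.kin L 0 x - T)) → c ≤ ((L : ℝ) - 1) * (γ * (1 - γ / T ^ 2 * MeasureTheory.integral ((Literature.MathematicalPhysics.KineticTheory.HeatConduction.pinnedChain ω₂ lam β γ).gibbsMeasure L T) (fun x => g x * (Summit.AtomisticToContinuum.FouriersLaw.Theorems.SuperadditiveResistance.DeviceLiouville.kin L 0 x - T))))) → (∀ (ω₂ lam β γ T ε : ℝ), 0 < ω₂ → 0 < lam → 0 < β → 0 < γ → 0 < T → 0 < ε → ∃ κ₀ : ℝ, 0 < κ₀ ∧ ∃ s₁ : ℝ, 0 < s₁ ∧ s₁ ≤ 1 ∧ ∀ s : ℝ, 0 < s → s ≤ s₁ → ∀ u : (L : ℕ) → Literature.MathematicalPhysics.KineticTheory.HeatConduction.PhaseSpace L → ℝ, (∀ L : ℕ, 2 ≤ L → ContDiff ℝ 2 (u L) ∧ MeasureTheory.MemLp (u L) 2 ((Literature.MathematicalPhysics.KineticTheory.HeatConduction.pinnedChain ω₂ lam β γ).gibbsMeasure L T) ∧ ∀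 x, (Literature.MathematicalPhysics.KineticTheory.HeatConduction.pinnedChain ω₂ lam β γ).flipGenerator L T T ε (u L) x = s * u L x - ∑ i : Fin L, (Literature.MathematicalPhysics.KineticTheory.HeatConduction.pinnedChain ω₂ lam β γ).bondCurrent L i x) → ∀ K : ℝ, Filter.Tendsto (fun L : ℕ => (MeasureTheory.integral ((Literature.MathematicalPhysics.KineticTheory.HeatConduction.pinnedChain ω₂ lam β γ).gibbsMeasure L T) (fun x => (∑ i : Fin L, (Literature.MathematicalPhysics.KineticTheory.HeatConduction.pinnedChain ω₂ lam β γ).bondCurrent L i x) * u L x)) / ((L : ℝ) - 1)) Filter.atTop (nhds K) → κ₀ * T ^ 2 ≤ K) :=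
  fun hFloor => bulkPositivity_of_kuboFloor hFloor

end Summit.AtomisticToContinuum.FouriersLaw.Theorems.NoisyFourier.KuboFloor

end
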